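import Mathlib
import Literature.MathematicalPhysics.StatisticalMechanics.Crystallization
import Summits.AtomisticToContinuum.Crystallization.Theorems.ThreeConeCertificateExactCertificateTransfer1DClass
import Summits.AtomisticToContinuum.Crystallization.Theorems.ThreeConeCertificateExactCertificateTransfer1DZeroContinuous
import Summits.AtomisticToContinuum.Crystallization.Theorems.ThreeConeCertificateExactCertificateTransfer1DZeroDerivative
import Summits.AtomisticToContinuum.Crystallization.Theorems.ThreeConeCertificateExactCertificateTransfer1DZeroSigns
import Summits.AtomisticToContinuum.Crystallization.Theorems.ThreeConeCertificateExactCertificateTransfer1DZeroCollapse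
import Summits.AtomisticToContinuum.Crystallization.Theorems.ThreeConeCertificateExactCertificateTransfer1DZeroAttain

/-!
# Crux `ExactCertificate` (stmt-AtomisticToContinuum-11959), line `closure-makes-nogap-exact`:
# TRANSFER VII — ZERO PRESSURE EXISTS: the class theorem with no zero-pressure input

Support file (`--supports stmt-AtomisticToContinuum-11959`); nothing here closes the 3-D crux, which stays `NoGap ∧ KeplerBound`
with `KeplerBound` = item 11961 ↔ 0627 (open).  Assembly of Transfer skeleton VII (`Cruxes/ExactCertificate/Lines/
closure_makes_nogap_exact_zeropressure1d.lean`, deciding decl `OneCrossingChainCrystallizes`), composing its five landed stubs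
(`stub_chainEnergyContinuous` p158654, `stub_zeroPressure_of_isMinOn` p158887, `stub_chainEnergy_signs` p158908,
`stub_chainEnergy_tendsto_zero_right` p159138, `stub_exists_isMinOn_of_limits` p158693) with Transfer V
(`hasPeriodicGroundStateEnergy_one_of_oneCrossing`, `exactCertificate_one_of_oneCrossing`, `chainEnergy_le_of_zeroPressure`).

Transfer V proved the exact certificate and energetic crystallization of the chain for every pair potential of the ONE-CROSSING
LAPLACE CLASS (`V(r) = −∫₀^∞e^{−tr}p(t)dt`, `p` measurable, `≥ 0` on `(0,t₀]`, `≤ 0` on `[t₀,∞)`, `|p(t)| ≤ C(t²+t^M)`, `M ≥ 2`) GIVEN a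
zero-pressure spacing.  Here that input is produced from two primitive hypotheses — a repulsive core `c r⁻² ≤ V(r)` on `(0, r₀]` and one
negative value `V(r₁) < 0`:

* `zeroPressure_iff_isMinOn` — for the class, a spacing `a > 0` is at ZERO PRESSURE (vanishing weighted first moments, the form Transfer V
  consumes) IFF it GLOBALLY MINIMISES the chain energy `b ↦ Σ_{m≥1}V(mb)` on `(0,∞)` (⇐ differentiate under the sum and the integral at an
  interior minimum; ⇒ the certificate's periodic Bochner inequality, `chainEnergy_le_of_zeroPressure`);
* `zeroPressure_exists_of_oneCrossing` — under the core bound and a negative value the chain energy is continuous on `(0,∞)`, tends to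
  `+∞` at `0⁺` and to `0` at `∞`, is negative at `r₁` (one crossing propagates negativity of `V` to the right), hence attains a negative
  minimum at some `a > 0`: a zero-pressure spacing EXISTS;
* `hasPeriodicGroundStateEnergy_one_of_core_of_neg` = registered `stub_zeroAssembly` = `OneCrossingChainCrystallizes` — **every such
  potential crystallizes energetically on the line**, `HasPeriodicGroundStateEnergy V 1`, with no zero-pressure input; and
  `exactCertificate_one_of_core_of_neg` — the crux `ExactCertificate` with `3 ↦ 1`, `lennardJones ↦ V` for every such potential.

All `[folklore]`.
-/

noncomputable section

namespace Summit.AtomisticToContinuum.Crystallization.Theorems.ThreeConeCertificateExactCertificate.Transfer1D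

open Literature.MathematicalPhysics.StatisticalMechanics MeasureTheory Set Filter Topology
open scoped BigOperators

/-- **Zero pressure ⇔ global minimum of the chain energy.**  For a one-crossing Laplace-class potential and `a > 0`: the `(k+1)`-weighted
first moments of `e^{−t(k+1)a}p(t)` sum to zero (zero pressure, `Σ_{m≥1} mV′(ma) = 0`) if and only if `a` minimises the chain energy
`b ↦ Σ_{m≥1}V(mb)` over `(0,∞)` — every critical point of the chain energy is its global minimum. [folklore] -/
theorem zeroPressure_iff_isMinOn {V p : ℝ → ℝ} {t₀ C a : ℝ} {M : ℕ} (hpm : Measurable p) (ht₀ : 0 < t₀)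
    (hpos : ∀ t : ℝ, 0 < t → t ≤ t₀ → 0 ≤ p t) (hneg : ∀ t : ℝ, t₀ ≤ t → p t ≤ 0) (hM : 2 ≤ M)
    (hbd : ∀ t : ℝ, 0 < t → |p t| ≤ C * (t ^ 2 + t ^ M))
    (hV : ∀ r : ℝ, 0 < r → V r = -(∫ t in Set.Ioi (0 : ℝ), Real.exp (-(t * r)) * p t))
    (ha : 0 < a) :
    HasSum (fun k : ℕ => ((k : ℝ) + 1) *
      ∫ t in Set.Ioi (0 : ℝ), Real.exp (-(t * (((k : ℝ) + 1) * a))) * p t * t) 0 ↔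
    IsMinOn (fun b : ℝ => ∑' k : ℕ, V (((k : ℝ) + 1) * b)) (Set.Ioi 0) a := by
  constructor
  · intro hz b hb
    exact chainEnergy_le_of_zeroPressure hpm ht₀ hpos hneg hM hbd hV ha hz hb
  · intro hmin
    exact stub_zeroPressure_of_isMinOn V p C a M hM hpm hbd hV ha hmin

/-- **A zero-pressure spacing exists.**  For a one-crossing Laplace-class potential with a repulsive core `c r⁻² ≤ V(r)` on `(0, r₀]`
(`c, r₀ > 0`) and a negative value `V(r₁) < 0` (`r₁ > 0`), the chain energy attains a (negative) global minimum over `(0,∞)` at some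
`a > 0`, which is therefore at zero pressure. [folklore] -/
theorem zeroPressure_exists_of_oneCrossing {V p : ℝ → ℝ} {t₀ C c r₀ r₁ : ℝ} {M : ℕ} (hpm : Measurable p) (ht₀ : 0 < t₀)
    (hpos : ∀ t : ℝ, 0 < t → t ≤ t₀ → 0 ≤ p t) (hneg : ∀ t : ℝ, t₀ ≤ t → p t ≤ 0) (hM : 2 ≤ M)
    (hbd : ∀ t : ℝ, 0 < t → |p t| ≤ C * (t ^ 2 + t ^ M))
    (hV : ∀ r : ℝ, 0 < r → V r = -(∫ t in Set.Ioi (0 : ℝ), Real.exp (-(t * r)) * p t))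
    (hc : 0 < c) (hr₀ : 0 < r₀) (hcore : ∀ r : ℝ, 0 < r → r ≤ r₀ → c * r⁻¹ ^ 2 ≤ V r)
    (hr₁ : 0 < r₁) (hVr₁ : V r₁ < 0) :
    ∃ a : ℝ, 0 < a ∧ IsMinOn (fun b : ℝ => ∑' k : ℕ, V (((k : ℝ) + 1) * b)) (Set.Ioi 0) a ∧
      (∑' k : ℕ, V (((k : ℝ) + 1) * a)) < 0 ∧
      HasSum (fun k : ℕ => ((k : ℝ) + 1) *
        ∫ t in Set.Ioi (0 : ℝ), Real.exp (-(t * (((k : ℝ) + 1) * a))) * p t * t) 0 := by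
  obtain ⟨-, hcont⟩ := stub_chainEnergyContinuous V p C M hM hpm hbd hV
  obtain ⟨-, -, hnegchain, hlim⟩ := stub_chainEnergy_signs V p t₀ C M hpm ht₀ hpos hneg hM hbd hV
  have hzero := stub_chainEnergy_tendsto_zero_right V p C c r₀ M hM hpm hbd hV hc hr₀ hcore
  have hn := hnegchain r₁ hr₁ hVr₁
  obtain ⟨a, ha, hmin⟩ := stub_exists_isMinOn_of_limits (fun b : ℝ => ∑' k : ℕ, V (((k : ℝ) + 1) * b))
    hcont hzero hlim ⟨r₁, hr₁, hn⟩
  refine ⟨a, ha, hmin, lt_of_le_of_lt (hmin (show r₁ ∈ Set.Ioi (0 : ℝ) from hr₁)) hn, ?_⟩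
  exact (zeroPressure_iff_isMinOn hpm ht₀ hpos hneg hM hbd hV ha).2 hmin

/-- **ENERGETIC CRYSTALLIZATION OF THE ONE-CROSSING CLASS, NO ZERO-PRESSURE INPUT** (the deciding statement
`OneCrossingChainCrystallizes` of Transfer skeleton VII): every pair potential `V(r) = −∫₀^∞e^{−tr}p(t)dt` with `p` measurable,
`p ≥ 0` on `(0,t₀]`, `p ≤ 0` on `[t₀,∞)`, `|p(t)| ≤ C(t²+t^M)` (`M ≥ 2`), a repulsive core `c r⁻² ≤ V(r)` on `(0,r₀]` and a negative value
`V(r₁) < 0` satisfies `HasPeriodicGroundStateEnergy V 1`: the ground-state energy per particle of `N` particles on a line converges to the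
minimum of the energy per particle over periodic configurations of `ℝ¹`, attained at a zero-pressure chain. [folklore] -/
theorem hasPeriodicGroundStateEnergy_one_of_core_of_neg {V p : ℝ → ℝ} {t₀ C c r₀ r₁ : ℝ} {M : ℕ} (hpm : Measurable p)
    (ht₀ : 0 < t₀) (hpos : ∀ t : ℝ, 0 < t → t ≤ t₀ → 0 ≤ p t) (hneg : ∀ t : ℝ, t₀ ≤ t → p t ≤ 0) (hM : 2 ≤ M)
    (hbd : ∀ t : ℝ, 0 < t → |p t| ≤ C * (t ^ 2 + t ^ M))
    (hV : ∀ r : ℝ, 0 < r → V r = -(∫ t in Set.Ioi (0 : ℝ), Real.exp (-(t * r)) * p t))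
    (hc : 0 < c) (hr₀ : 0 < r₀) (hcore : ∀ r : ℝ, 0 < r → r ≤ r₀ → c * r⁻¹ ^ 2 ≤ V r)
    (hr₁ : 0 < r₁) (hVr₁ : V r₁ < 0) :
    HasPeriodicGroundStateEnergy V 1 := by
  obtain ⟨a, ha, -, -, hz⟩ := zeroPressure_exists_of_oneCrossing hpm ht₀ hpos hneg hM hbd hV hc hr₀ hcore hr₁ hVr₁
  exact hasPeriodicGroundStateEnergy_one_of_oneCrossing hpm ht₀ hpos hneg hM hbd hV ha hz

/-- **Registered stub `stub_zeroAssembly`** — the deciding statement `OneCrossingChainCrystallizes` of Transfer skeleton VII as a closed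
proposition (= `hasPeriodicGroundStateEnergy_one_of_core_of_neg`). [folklore] -/
theorem stub_zeroAssembly : ∀ (V p : ℝ → ℝ) (t₀ C c r₀ r₁ : ℝ) (M : ℕ), Measurable p → 0 < t₀ →
    (∀ t : ℝ, 0 < t → t ≤ t₀ → 0 ≤ p t) → (∀ t : ℝ, t₀ ≤ t → p t ≤ 0) → 2 ≤ M →
    (∀ t : ℝ, 0 < t → |p t| ≤ C * (t ^ 2 + t ^ M)) →
    (∀ r : ℝ, 0 < r → V r = -(∫ t in Set.Ioi (0 : ℝ), Real.exp (-(t * r)) * p t)) →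
    0 < c → 0 < r₀ → (∀ r : ℝ, 0 < r → r ≤ r₀ → c * r⁻¹ ^ 2 ≤ V r) →
    0 < r₁ → V r₁ < 0 →
    HasPeriodicGroundStateEnergy V 1 :=
  fun _ _ _ _ _ _ _ _ hpm ht₀ hpos hneg hM hbd hV hc hr₀ hcore hr₁ hVr₁ =>
    hasPeriodicGroundStateEnergy_one_of_core_of_neg hpm ht₀ hpos hneg hM hbd hV hc hr₀ hcore hr₁ hVr₁

/-- **The exact certificate for the class, no zero-pressure input**: under the same primitive hypotheses the crux `ExactCertificate` holds
VERBATIM with `3 ↦ 1` and `lennardJones ↦ V` (at the zero-pressure spacing of `zeroPressure_exists_of_oneCrossing`). [folklore] -/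
theorem exactCertificate_one_of_core_of_neg {V p : ℝ → ℝ} {t₀ C c r₀ r₁ : ℝ} {M : ℕ} (hpm : Measurable p)
    (ht₀ : 0 < t₀) (hpos : ∀ t : ℝ, 0 < t → t ≤ t₀ → 0 ≤ p t) (hneg : ∀ t : ℝ, t₀ ≤ t → p t ≤ 0) (hM : 2 ≤ M)
    (hbd : ∀ t : ℝ, 0 < t → |p t| ≤ C * (t ^ 2 + t ^ M))
    (hV : ∀ r : ℝ, 0 < r → V r = -(∫ t in Set.Ioi (0 : ℝ), Real.exp (-(t * r)) * p t))
    (hc : 0 < c) (hr₀ : 0 < r₀) (hcore : ∀ r : ℝ, 0 < r → r ≤ r₀ → c * r⁻¹ ^ 2 ≤ V r)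
    (hr₁ : 0 < r₁) (hVr₁ : V r₁ < 0) :
    ∃ (P : PeriodicConfiguration 1) (ρ c' : ℝ) (g U f : ℝ → ℝ),
      (∀ r : ℝ, 0 < r → V r = g r + U r + f r) ∧ (∀ r : ℝ, 0 < r → 0 ≤ U r) ∧
      (∀ r : ℝ, ρ ≤ r → g r = 0) ∧
      (∀ (n : ℕ) (y : Fin n → EuclideanSpace ℝ (Fin 1)) (w : Fin n → ℝ),
        0 ≤ ∑ i, ∑ j, w i * w j * f (dist (y i) (y j))) ∧
      (∀ (N : ℕ) (x : Fin N → EuclideanSpace ℝ (Fin 1)), Function.Injective x →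
        -(c' * (N : ℝ)) ≤ interactionEnergy g x) ∧
      c' + f 0 / 2 = -(P.energyPerParticle V) := by
  obtain ⟨a, ha, -, -, hz⟩ := zeroPressure_exists_of_oneCrossing hpm ht₀ hpos hneg hM hbd hV hc hr₀ hcore hr₁ hVr₁
  exact exactCertificate_one_of_oneCrossing hpm ht₀ hpos hneg hM hbd hV ha hz

end Summit.AtomisticToContinuum.Crystallization.Theorems.ThreeConeCertificateExactCertificate.Transfer1D

end
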